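import Literature.Topology.FourManifolds.AlexanderPresentationOfCut
import HarnessLib

/-!
# Integer combinations from a `ℤ`-basis

Topic `Literature/Topology/FourManifolds`; a small interface lemma for
`CutData.exists_presentation(_laurent)` (`AlexanderPresentationOfCut.lean`), whose basis hypotheses
are phrased with the additive map `CutData.comb y : ℤⁿ →+ H₁(Y; ℤ)`, `u ↦ ∑ₗ uₗ • yₗ` (integer
MULTIPLES, the `ℤ`-action of the additive group), rather than with Mathlib's `Module.Basis` (whose
scalar action is the `Module ℤ` structure of the `ModuleCat ℤ` object; the two agree
propositionally, `int_smul_eq_zsmul`, not syntactically). Here we bridge the two: a `Module.Basis`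
of `H₁(Y; ℤ)` indexed by `Fin n` yields the two `comb`-hypotheses `hspan`, `hind`.
Everything is proved. [folklore]

## References

* D. Rolfsen, *Knots and Links*, Publish or Perish (1976), §8.C. [Rolfsen1976]
-/

noncomputable section

open Literature.AlgebraicTopology.SingularHomology

universe u

namespace Literature.Topology.FourManifolds

namespace CircleMaps

namespace CyclicCover

namespace CutData

variable {X : Type u} [TopologicalSpace X] {f : C(X, Circle)} (D : CutData f) {n : ℕ}

/-- **Span**: every class is an integer combination of a `ℤ`-basis. [folklore] -/
theorem exists_eq_comb_of_basis (b : Module.Basis (Fin n) ℤ (singularHomology ℤ ℤ ↥D.Y 1))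
    (x : singularHomology ℤ ℤ ↥D.Y 1) : ∃ u : Fin n → ℤ, x = comb (⇑b) u := by
  refine ⟨fun l => b.repr x l, ?_⟩
  have h := b.sum_repr x
  rw [comb_apply]
  -- the `Module ℤ`-action of the basis is the integer-multiple action (`int_smul_eq_zsmul`)
  exact h.symm.trans (Finset.sum_congr rfl fun i _ => int_smul_eq_zsmul _ _ _)

/-- **Independence**: an integer combination of a `ℤ`-basis vanishes only trivially. [folklore] -/
theorem eq_zero_of_comb_basis_eq_zero (b : Module.Basis (Fin n) ℤ (singularHomology ℤ ℤ ↥D.Y 1))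
    (u : Fin n → ℤ) (hu : comb (⇑b) u = 0) : u = 0 := by
  funext l
  refine Fintype.linearIndependent_iff.1 b.linearIndependent u ?_ l
  rw [comb_apply] at hu
  exact (Finset.sum_congr rfl fun i _ => int_smul_eq_zsmul _ _ _).trans hu

end CutData

end CyclicCover

end CircleMaps

end Literature.Topology.FourManifolds
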